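import Mathlib
import Literature.MeasureTheory.Lebesgue.VitaliSet
import Summits.AnomalousDissipation.AnomalousDissipation.Theses.TwoAndHalfD

/-!
# Route TwoAndHalfD (AnomalousDissipation) — tools for the refutation of the support item
  `ScalarLift2halfD` (stmt-AnomalousDissipation-14324): the non-measurable-datum loophole of
  `Torus.IsLerayHopfOn`

Support file (everything proved) for
`Summits/AnomalousDissipation/AnomalousDissipation/Theorems/TwoAndHalfDScalarLift2halfDRefutation.lean`.
The accepted structure `Literature.Analysis.FluidPDE.Torus.IsLerayHopfOn`
(`Literature/Analysis/FluidPDE/LerayHopf.lean`) constrains the datum `u₀` only through Bochner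
integrals (`∫ ⟪u₀, ψ 0⟫` in `Torus.IsWeakNSSolutionForcedOn`, `kineticEnergy u₀ = ½ ∫ ‖u₀‖²`,
`∫ ⟪u₀, w⟫` in `weak_continuous`) — junk-valued (`0`) on non-a.e.-strongly-measurable
integrands — and through the *lower* Lebesgue integral `eLpNorm (u t - u₀) 2` of
`strong_initial`, which vanishes on every function supported in a set of inner measure zero.
This file provides:

* §1 `lintegral_eq_zero_of_innerNull`, `integral_eq_zero_of_innerNull`,
  `eLpNorm_two_eq_zero_of_innerNull` — lower / Bochner integrals and `L²` seminorms of functions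
  vanishing off a set all of whose measurable subsets are null are `0` (no measurability);
* §2 `exists_innerNull_not_nullMeasurableSet_unitAddCircle` — a Vitali set on `ℝ/ℤ` (inner
  measure zero, not null-measurable), transported from the tree's
  `Literature.MeasureTheory.Lebesgue.Vitali.exists_innerNull_not_nullMeasurableSet`
  (Wheeden–Zygmund 1977, Thm. (3.38)–Cor. (3.39)) along the covering map, which is injective and
  measure preserving on `(0, 1]` (`UnitAddCircle.measurePreserving_mk`);
* §3 `innerNull_coordSlab`, `not_nullMeasurableSet_coordSlab` — both properties lift to the
  coordinate slabs `{x : (ℝ/ℤ)^{n+1} | x 0 ∈ A₀}` (Fubini through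
  `MeasurableEquiv.piFinSuccAbove`);
* §4 `isLerayHopfOn_zero_of_innerNull` — **the loophole**: the zero field is a Leray–Hopf weak
  solution on `T^d × [0, T)` (viscosity `1`, zero force) "with datum" `𝟙_C e` for every
  `C ⊆ T^d` of inner measure zero, e.g. a non-null-measurable coordinate slab, for which the
  datum is not even measurable.

Precedent for the loophole and its repair (`AEStronglyMeasurable u₀`):
`Literature/Analysis/FluidPDE/DistributionalToWeakCounterexample.lean`.
-/

noncomputable section

open MeasureTheory Set Filter Topology Function
open scoped ENNReal NNReal InnerProductSpace ContDiff

namespace Summit.AnomalousDissipation.AnomalousDissipation.Theorems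

-- D-0017: single-problem summit ⇒ `Summit.AnomalousDissipation.AnomalousDissipation.…`.
set_option linter.dupNamespace false

open Literature.Analysis.FunctionSpaces Literature.Analysis.FunctionSpaces.Torus
open Literature.Analysis.FluidPDE Literature.Analysis.FluidPDE.Torus

/-! ### 1. Junk integrals over sets of inner measure zero -/

section InnerNull

variable {α : Type*} [MeasurableSpace α] {μ : Measure α} {C : Set α}

/-- **Lower integrals do not see sets of inner measure zero.** If every measurable subset of `C`
is `μ`-null, then every function `f : α → [0, ∞]` vanishing off `C` (measurable or not) has
`∫⁻ f dμ = 0`: Mathlib's `lintegral` is the supremum over *simple* (measurable) minorants, and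
the support of a simple minorant of `f` is a measurable subset of `C`. [folklore] -/
theorem lintegral_eq_zero_of_innerNull
    (hC : ∀ M : Set α, MeasurableSet M → M ⊆ C → μ M = 0)
    {f : α → ℝ≥0∞} (hf : ∀ x, x ∉ C → f x = 0) : ∫⁻ x, f x ∂μ = 0 := by
  rw [lintegral_def]
  refine le_antisymm (iSup₂_le fun g hg => ?_) bot_le
  have hB : μ {x | (g : α → ℝ≥0∞) x ≠ 0} = 0 := by
    refine hC _ (g.measurableSet_preimage {0}ᶜ) fun x hx => ?_
    by_contra hxC
    have h1 : (g : α → ℝ≥0∞) x ≤ f x := hg x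
    rw [hf x hxC] at h1
    exact hx (le_antisymm h1 bot_le)
  have hg0 : (g : α → ℝ≥0∞) =ᵐ[μ] 0 := by
    rw [EventuallyEq, ae_iff]
    simpa using hB
  rw [← SimpleFunc.lintegral_eq_lintegral, lintegral_congr_ae hg0]
  simp

/-- **Bochner integrals do not see sets of inner measure zero either**: a function vanishing off
such a set `C` has `∫ f dμ = 0` (by `‖∫ f‖ ≤ (∫⁻ ‖f‖).toReal`, valid without measurability, and
`lintegral_eq_zero_of_innerNull`). [folklore] -/
theorem integral_eq_zero_of_innerNull
    (hC : ∀ M : Set α, MeasurableSet M → M ⊆ C → μ M = 0)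
    {E : Type*} [NormedAddCommGroup E] [NormedSpace ℝ E] {f : α → E}
    (hf : ∀ x, x ∉ C → f x = 0) : ∫ x, f x ∂μ = 0 := by
  have h := norm_integral_le_lintegral_norm (μ := μ) f
  have h0 : ∫⁻ x, ENNReal.ofReal ‖f x‖ ∂μ = 0 :=
    lintegral_eq_zero_of_innerNull hC fun x hx => by simp [hf x hx]
  rw [h0, ENNReal.toReal_zero] at h
  exact norm_le_zero_iff.1 h

/-- The `L²` seminorm (a lower integral) of a function vanishing off a set of inner measure zero
vanishes. [folklore] -/
theorem eLpNorm_two_eq_zero_of_innerNull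
    (hC : ∀ M : Set α, MeasurableSet M → M ⊆ C → μ M = 0)
    {E : Type*} [NormedAddCommGroup E] {f : α → E} (hf : ∀ x, x ∉ C → f x = 0) :
    eLpNorm f 2 μ = 0 := by
  rw [eLpNorm_eq_lintegral_rpow_enorm_toReal two_ne_zero ENNReal.ofNat_ne_top,
    lintegral_eq_zero_of_innerNull hC (f := fun x => ‖f x‖ₑ ^ (2 : ℝ≥0∞).toReal)
      fun x hx => by simp [hf x hx]]
  simp

end InnerNull

/-! ### 2. A set of inner measure zero on the circle which is not null-measurable -/

/-- **Vitali's set on the unit circle `ℝ/ℤ`.** There is `A₀ ⊆ UnitAddCircle` which is not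
null-measurable for the Haar probability measure while all its measurable subsets are null: the
image under `ℝ → ℝ/ℤ` of the tree's Vitali set inside the window `(0, 1)`
(`Literature.MeasureTheory.Lebesgue.Vitali.exists_innerNull_not_nullMeasurableSet`, Wheeden–Zygmund
1977, Thm. (3.38)–Cor. (3.39)), the covering map being injective and measure preserving on
`(0, 1]` (`UnitAddCircle.measurePreserving_mk`). [folklore] -/
theorem exists_innerNull_not_nullMeasurableSet_unitAddCircle :
    ∃ A₀ : Set UnitAddCircle, ¬ NullMeasurableSet A₀ volume ∧
      ∀ B : Set UnitAddCircle, MeasurableSet B → B ⊆ A₀ → volume B = 0 := by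
  obtain ⟨A, hAnull, hAnm⟩ :=
    Literature.MeasureTheory.Lebesgue.Vitali.exists_innerNull_not_nullMeasurableSet
      (volume : Measure ℝ) (ContinuousLinearMap.id ℝ ℝ) (e := (1 : ℝ)) rfl (fun x => by simp)
      (by simp) (1 / 2 : ℝ) (r := 1 / 2) (by norm_num)
  set S : Set ℝ := A ∩ Ioo 0 1 with hS_def
  have hball : Metric.ball (1 / 2 : ℝ) (1 / 2) = Ioo 0 1 := by
    rw [Real.ball_eq_Ioo]; norm_num
  have hSnm : ¬ NullMeasurableSet S volume := hAnm S (by rw [hball]) inter_subset_left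
  have hSsub : S ⊆ Ioo 0 1 := inter_subset_right
  set π : ℝ → UnitAddCircle := fun x => (x : UnitAddCircle) with hπ
  have hmp : MeasurePreserving π (volume.restrict (Ioc (0 : ℝ) (0 + 1))) volume :=
    UnitAddCircle.measurePreserving_mk 0
  -- `π` is injective on `(0, 1]`
  have hinj : ∀ x ∈ Ioc (0 : ℝ) 1, ∀ s ∈ Ioc (0 : ℝ) 1, π x = π s → x = s := by
    intro x hx s hs h
    have hx' : x ∈ Ioc (0 : ℝ) (0 + 1) := by simpa using hx
    have hs' : s ∈ Ioc (0 : ℝ) (0 + 1) := by simpa using hs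
    have h1 := AddCircle.equivIoc_coe_eq (p := (1 : ℝ)) (a := 0) hx'
    have h2 := AddCircle.equivIoc_coe_eq (p := (1 : ℝ)) (a := 0) hs'
    have h3 : (AddCircle.equivIoc 1 0) (π x) = (AddCircle.equivIoc 1 0) (π s) := by rw [h]
    simp only [hπ] at h3
    rw [h1, h2] at h3
    exact congrArg Subtype.val h3
  -- the key inclusion `π⁻¹(π S) ∩ (0, 1] ⊆ S`
  have hpre : π ⁻¹' (π '' S) ∩ Ioc 0 1 ⊆ S := by
    rintro x ⟨⟨s, hs, hsx⟩, hx⟩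
    have hsI : s ∈ Ioc (0 : ℝ) 1 := Ioo_subset_Ioc_self (hSsub hs)
    rw [hinj x hx s hsI hsx.symm]
    exact hs
  refine ⟨π '' S, fun hnm => hSnm ?_, fun B hB hBA => ?_⟩
  · -- null-measurability of `π '' S` would descend to `S`
    have h1 : NullMeasurableSet (π ⁻¹' (π '' S)) (volume.restrict (Ioc (0 : ℝ) (0 + 1))) :=
      hnm.preimage hmp.quasiMeasurePreserving
    obtain ⟨M, -, hM, hMae⟩ := h1.exists_measurable_subset_ae_eq
    have hMae' : ∀ᵐ x ∂(volume : Measure ℝ), x ∈ Ioc (0 : ℝ) 1 →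
        (x ∈ M ↔ x ∈ π ⁻¹' (π '' S)) := by
      have h2 := eventuallyEq_set.1 hMae
      rw [zero_add] at h2
      exact (ae_restrict_iff' measurableSet_Ioc).1 h2
    refine ((hM.inter (measurableSet_Ioo (a := (0 : ℝ)) (b := 1))).nullMeasurableSet).congr
      (eventuallyEq_set.2 ?_)
    filter_upwards [hMae'] with x hx
    constructor
    · rintro ⟨hxM, hxI⟩
      exact hpre ⟨(hx (Ioo_subset_Ioc_self hxI)).1 hxM, Ioo_subset_Ioc_self hxI⟩
    · intro hxS
      have hxI : x ∈ Ioo (0 : ℝ) 1 := hSsub hxS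
      exact ⟨(hx (Ioo_subset_Ioc_self hxI)).2 ⟨x, hxS, rfl⟩, hxI⟩
  · -- measurable subsets of `π '' S` are null
    have hBpre : MeasurableSet (π ⁻¹' B) := hB.preimage AddCircle.measurable_mk'
    rw [← hmp.measure_preimage hB.nullMeasurableSet, Measure.restrict_apply hBpre, zero_add]
    refine hAnull _ (hBpre.inter measurableSet_Ioc) fun x hx => ?_
    exact (hpre ⟨hBA hx.1, hx.2⟩).1

/-! ### 3. Coordinate slabs in the torus `(ℝ/ℤ)^{n+1}` -/

section Coord

variable {n : ℕ} {A₀ : Set UnitAddCircle}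

/-- **Inner measure zero lifts to coordinate slabs**: if all measurable subsets of
`A₀ ⊆ ℝ/ℤ` are null, so are all measurable subsets of `{x : (ℝ/ℤ)^{n+1} | x 0 ∈ A₀}` (split off
the `0`-th coordinate, `MeasurableEquiv.piFinSuccAbove`, and compute the product measure by
slices, `Measure.prod_apply`: the slice function vanishes off `A₀`). [folklore] -/
theorem innerNull_coordSlab
    (hA : ∀ B : Set UnitAddCircle, MeasurableSet B → B ⊆ A₀ → volume B = 0)
    (M : Set (Fin (n + 1) → UnitAddCircle)) (hM : MeasurableSet M) (hMC : M ⊆ {x | x 0 ∈ A₀}) :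
    volume M = 0 := by
  set e := MeasurableEquiv.piFinSuccAbove (fun _ : Fin (n + 1) => UnitAddCircle) 0 with he
  have hmp : MeasurePreserving e volume volume :=
    volume_preserving_piFinSuccAbove (fun _ => UnitAddCircle) 0
  set M' : Set (UnitAddCircle × (Fin n → UnitAddCircle)) := e.symm ⁻¹' M with hM'
  have hM'm : MeasurableSet M' := e.symm.measurable hM
  have hMeq : M = e ⁻¹' M' := by
    ext x
    simp [hM']
  have h1 : volume M = volume M' := by
    rw [hMeq]
    exact hmp.measure_preimage hM'm.nullMeasurableSet
  rw [h1, show (volume : Measure (UnitAddCircle × (Fin n → UnitAddCircle))) = volume.prod volume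
    from rfl, Measure.prod_apply hM'm]
  refine lintegral_eq_zero_of_innerNull hA (C := A₀) fun a ha => ?_
  have hempty : Prod.mk a ⁻¹' M' = ∅ := by
    ext y
    simp only [mem_preimage, mem_empty_iff_false, iff_false]
    intro hy
    have h2 : (e.symm (a, y)) 0 ∈ A₀ := hMC hy
    simp [he] at h2
    exact ha h2
  rw [hempty, measure_empty]

/-- **Non-null-measurability lifts to coordinate slabs**: if `A₀ ⊆ ℝ/ℤ` is not null-measurable,
neither is `{x : (ℝ/ℤ)^{n+1} | x 0 ∈ A₀}` — otherwise `A₀ ×ˢ univ` is a.e. equal to a measurable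
`M`, so by Fubini for a.e. `a` the slice `M_a` is a.e. `univ` or a.e. `∅` according as `a ∈ A₀`
or not, exhibiting `A₀` as a.e. equal to the measurable set `{a | vol (M_a) = 1}`. [folklore] -/
theorem not_nullMeasurableSet_coordSlab (hA : ¬ NullMeasurableSet A₀ volume) :
    ¬ NullMeasurableSet {x : Fin (n + 1) → UnitAddCircle | x 0 ∈ A₀} volume := by
  intro hC
  set e := MeasurableEquiv.piFinSuccAbove (fun _ : Fin (n + 1) => UnitAddCircle) 0 with he
  have hmp : MeasurePreserving e volume volume :=
    volume_preserving_piFinSuccAbove (fun _ => UnitAddCircle) 0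
  have h1 : NullMeasurableSet (e.symm ⁻¹' {x : Fin (n + 1) → UnitAddCircle | x 0 ∈ A₀})
      (volume : Measure (UnitAddCircle × (Fin n → UnitAddCircle))) :=
    hC.preimage hmp.symm.quasiMeasurePreserving
  have h2 : e.symm ⁻¹' {x : Fin (n + 1) → UnitAddCircle | x 0 ∈ A₀} = A₀ ×ˢ univ := by
    ext p
    obtain ⟨a, y⟩ := p
    simp [he]
  rw [h2] at h1
  obtain ⟨M, -, hM, hMae⟩ := h1.exists_measurable_subset_ae_eq
  have h3 : ∀ᵐ a ∂(volume : Measure UnitAddCircle),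
      ∀ᵐ y ∂(volume : Measure (Fin n → UnitAddCircle)),
        ((a, y) ∈ M ↔ (a, y) ∈ A₀ ×ˢ (univ : Set (Fin n → UnitAddCircle))) :=
    Measure.ae_ae_of_ae_prod (eventuallyEq_set.1 hMae)
  set g : UnitAddCircle → ℝ≥0∞ := fun a => volume (Prod.mk a ⁻¹' M) with hg
  have hgm : Measurable g := measurable_measure_prodMk_left hM
  refine hA (((hgm (measurableSet_singleton 1)).nullMeasurableSet).congr (eventuallyEq_set.2 ?_))
  filter_upwards [h3] with a ha
  simp only [mem_prod, mem_univ, and_true] at ha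
  simp only [mem_preimage, mem_singleton_iff, hg]
  constructor
  · intro hone
    by_contra haA
    have h4 : ∀ᵐ y ∂(volume : Measure (Fin n → UnitAddCircle)), (a, y) ∉ M := by
      filter_upwards [ha] with y hy using fun h => haA (hy.1 h)
    have h5 : volume (Prod.mk a ⁻¹' M) = 0 := by
      have h6 := ae_iff.1 h4
      simp only [not_not] at h6
      exact h6
    rw [h5] at hone
    exact zero_ne_one hone
  · intro haA
    have h4 : ∀ᵐ y ∂(volume : Measure (Fin n → UnitAddCircle)), (a, y) ∈ M := by
      filter_upwards [ha] with y hy using hy.2 haA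
    have hc : volume (Prod.mk a ⁻¹' M)ᶜ = 0 := by
      have h6 := ae_iff.1 h4
      exact h6
    exact (prob_compl_eq_zero_iff (measurable_prodMk_left hM)).1 hc

/-- **The witness datum misses the repaired hypothesis**: for a non-null-measurable `A₀` and
`e ≠ 0`, the field `𝟙_C e` on the slab `C = {x | x 0 ∈ A₀}` is not a.e.-strongly measurable
(its support `C` would be null-measurable), hence in no `Lᵖ`. [folklore] -/
theorem not_aestronglyMeasurable_indicator_coordSlab (hA : ¬ NullMeasurableSet A₀ volume)
    {E : Type*} [NormedAddCommGroup E] {e : E} (he : e ≠ 0) :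
    ¬ AEStronglyMeasurable
      ({x : Fin (n + 1) → UnitAddCircle | x 0 ∈ A₀}.indicator fun _ => e) volume := by
  intro h
  have hs := h.nullMeasurableSet_support
  rw [support_indicator, support_const he, inter_univ] at hs
  exact not_nullMeasurableSet_coordSlab hA hs

end Coord

/-! ### 4. The zero "solution" with a junk datum is Leray–Hopf -/

section Planar


/-- The spectral dissipation of the zero field vanishes (every Fourier coefficient of `0` is
`0`). [folklore] -/
theorem eGradNormSq_zero_field {d : Type*} [Fintype d] :
    eGradNormSq (0 : UnitAddTorus d → EuclideanSpace ℝ d) = 0 := by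
  have hc : (EuclideanSpace.complexify ∘ (0 : UnitAddTorus d → EuclideanSpace ℝ d)) = 0 := by
    funext x
    simp
  have h : ∀ k : d → ℤ,
      UnitAddTorus.mFourierCoeff (0 : UnitAddTorus d → EuclideanSpace ℂ d) k = 0 := by
    intro k
    simp [UnitAddTorus.mFourierCoeff]
  unfold eGradNormSq eHomSobolevSeminorm
  rw [hc]
  simp [h, ENNReal.zero_rpow_of_pos]

/-- **The loophole.** For every set `C ⊆ T^d` all of whose measurable subsets are null and every
vector `e`, the zero field is a Leray–Hopf weak solution on `T^d × [0, T)` (viscosity `1`, zero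
force) "with datum" `𝟙_C e`, in the sense of the accepted `Torus.IsLerayHopfOn`: all clauses
involving the datum are junk-valued — the Bochner pairings `∫ ⟪𝟙_C e, ·⟫` vanish
(`integral_eq_zero_of_innerNull`), `kineticEnergy (𝟙_C e) ≥ 0`, and
`eLpNorm (0 - 𝟙_C e) 2 = 0` (`eLpNorm_two_eq_zero_of_innerNull`). For a non-null-measurable `C`
the datum is not even measurable. [folklore] -/
theorem isLerayHopfOn_zero_of_innerNull {d : Type*} [Fintype d] [DecidableEq d]
    {C : Set (UnitAddTorus d)}
    (hC : ∀ M : Set (UnitAddTorus d), MeasurableSet M → M ⊆ C → volume M = 0)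
    (e : EuclideanSpace ℝ d) (T : ℝ) :
    IsLerayHopfOn T 1 (fun _ => (0 : UnitAddTorus d → EuclideanSpace ℝ d))
      (C.indicator fun _ => e) (fun _ => (0 : UnitAddTorus d → EuclideanSpace ℝ d)) := by
  have hv₀ : ∀ x, x ∉ C → C.indicator (fun _ => e) x = 0 := fun x hx =>
    indicator_of_notMem hx _
  have hint : ∀ w : UnitAddTorus d → EuclideanSpace ℝ d,
      ∫ x, ⟪C.indicator (fun _ => e) x, w x⟫_ℝ = 0 := fun w =>
    integral_eq_zero_of_innerNull hC fun x hx => by rw [hv₀ x hx, inner_zero_left]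
  have hE0 : eGradNormSq (0 : UnitAddTorus d → EuclideanSpace ℝ d) = 0 := eGradNormSq_zero_field
  have hK0 : kineticEnergy (0 : UnitAddTorus d → EuclideanSpace ℝ d) = 0 := by
    simp [kineticEnergy]
  have hc0 : (EuclideanSpace.complexify ∘ (0 : UnitAddTorus d → EuclideanSpace ℝ d)) = 0 := by
    funext x
    simp
  refine ⟨⟨?_, ?_, ?_, ?_⟩, ⟨0, ae_of_all _ fun t => by simp⟩, fun t _ => MemLp.zero,
    ⟨?_, ?_⟩, ?_, ?_, ?_, ?_⟩
  · exact aestronglyMeasurable_const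
  · simp
  · exact ae_of_all _ fun t θ _ => by simp
  · intro ψ _ _
    simp [hint (ψ 0)]
  · exact ae_of_all _ fun t => by
      show MemSobolev 1
        (EuclideanSpace.complexify ∘ (0 : UnitAddTorus d → EuclideanSpace ℝ d))
      rw [hc0]
      exact memSobolev_zero_fun 1
  · show eL2SobolevNorm 0 T 1
      (fun _ => EuclideanSpace.complexify ∘ (0 : UnitAddTorus d → EuclideanSpace ℝ d)) < ⊤
    rw [hc0]
    simp [eL2SobolevNorm]
  · intro t _
    simp only [hE0, hK0, lintegral_const, zero_mul, ENNReal.toReal_zero, mul_zero, add_zero,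
      Pi.zero_apply, inner_zero_left, integral_zero, intervalIntegral.integral_zero]
    exact kineticEnergy_nonneg _
  · refine ae_of_all _ fun s t _ => ?_
    simp [hE0, hK0]
  · intro w _
    refine ⟨?_, ?_⟩
    · simp only [Pi.zero_apply, inner_zero_left, integral_zero]
      exact continuousOn_const
    · simp only [Pi.zero_apply, inner_zero_left, integral_zero, hint w]
      exact tendsto_const_nhds
  · have h0 : eLpNorm ((0 : UnitAddTorus d → EuclideanSpace ℝ d) - C.indicator fun _ => e) 2
        volume = 0 := by
      rw [zero_sub, eLpNorm_neg]
      exact eLpNorm_two_eq_zero_of_innerNull hC hv₀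
    show Tendsto (fun _ : ℝ => eLpNorm
        ((0 : UnitAddTorus d → EuclideanSpace ℝ d) - C.indicator fun _ => e) 2 volume)
      (𝓝[>] 0) (𝓝 0)
    rw [h0]
    exact tendsto_const_nhds

end Planar

end Summit.AnomalousDissipation.AnomalousDissipation.Theorems
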